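import Mathlib.Analysis.CStarAlgebra.Matrix
import Literature.Computability.Cryptography.QubitRegisterProofs
import HarnessLib

/-!
# Operator norm of reindexed, Kronecker-extended and placed gates

Topic `Literature/Computability/QuantumComplexity`. Proof infrastructure for the
`PromiseBQP`-hardness of the Jones polynomial (Aharonov–Arad 2011, Thm. 3.1; the error of the
simulation is accumulated gate by gate in the `L²`-operator norm, Claim 3.1): three elementary
facts about the `L²`-operator norm of matrices (scope `Matrix.Norms.L2Operator`):

* `l2_opNorm_le_of_forall_mulVec` — the bound principle `‖A‖ ≤ C` from `‖A v‖ ≤ C ‖v‖`;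
* `l2_opNorm_reindex` — reindexing along equivalences preserves the norm;
* `l2_opNorm_kronecker_one_le` — `‖U ⊗ 1‖ ≤ ‖U‖`; hence **`norm_placeGate_le`**: placing a gate on
  some wires of a register does not increase its norm, `‖placeGate e U‖ ≤ ‖U‖`
  (`placeGate_eq_reindex_kronecker_holds`).

## References

* D. Aharonov, I. Arad, New J. Phys. 13 (2011) 035019, Claim 3.1 [AharonovArad2011].
* M. A. Nielsen, I. L. Chuang, *Quantum Computation and Quantum Information*, CUP 2010, §4.3
  [NielsenChuang2010].
-/

noncomputable section

open scoped Matrix.Norms.L2Operator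

namespace Literature.Computability.QuantumComplexity

open Matrix Cryptography WithLp

section Generic

variable {m n m' n' : Type*} [Fintype m] [DecidableEq m] [Fintype n] [DecidableEq n]
  [Fintype m'] [DecidableEq m'] [Fintype n'] [DecidableEq n']

omit [DecidableEq m] in
/-- **The bound principle** for the `L²`-operator norm. [folklore] -/
theorem l2_opNorm_le_of_forall_mulVec (A : Matrix m n ℂ) {C : ℝ} (hC : 0 ≤ C)
    (h : ∀ x : EuclideanSpace ℂ n, ‖(toLp 2 (A *ᵥ ofLp x) : EuclideanSpace ℂ m)‖ ≤ C * ‖x‖) : ‖A‖ ≤ C := by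
  rw [Matrix.l2_opNorm_def]
  exact ContinuousLinearMap.opNorm_le_bound _ hC fun x => h x

omit [DecidableEq m] in
/-- The basic estimate `‖A v‖ ≤ ‖A‖ ‖v‖`. [folklore] -/
theorem norm_toLp_mulVec_le (A : Matrix m n ℂ) (x : EuclideanSpace ℂ n) :
    ‖(toLp 2 (A *ᵥ ofLp x) : EuclideanSpace ℂ m)‖ ≤ ‖A‖ * ‖x‖ :=
  Matrix.l2_opNorm_mulVec A x

omit [DecidableEq n] [DecidableEq n'] in
/-- Reindexing the coordinates of a Euclidean vector preserves its norm. [folklore] -/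
theorem norm_toLp_comp_equiv (e : n' ≃ n) (v : n → ℂ) :
    ‖(toLp 2 (v ∘ e) : EuclideanSpace ℂ n')‖ = ‖(toLp 2 v : EuclideanSpace ℂ n)‖ := by
  rw [EuclideanSpace.norm_eq, EuclideanSpace.norm_eq]
  congr 1
  exact Fintype.sum_equiv e _ _ fun i => rfl

omit [DecidableEq m] [DecidableEq m'] in
/-- Reindexing does not increase the norm. [folklore] -/
theorem l2_opNorm_reindex_le (eₘ : m ≃ m') (eₙ : n ≃ n') (A : Matrix m n ℂ) : ‖Matrix.reindex eₘ eₙ A‖ ≤ ‖A‖ := by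
  refine l2_opNorm_le_of_forall_mulVec _ (norm_nonneg A) fun x => ?_
  rw [Matrix.reindex_apply, Matrix.submatrix_mulVec_equiv, Equiv.symm_symm]
  have h1 : ‖(toLp 2 ((A *ᵥ (ofLp x ∘ eₙ)) ∘ eₘ.symm) : EuclideanSpace ℂ m')‖ =
      ‖(toLp 2 (A *ᵥ (ofLp x ∘ eₙ)) : EuclideanSpace ℂ m)‖ := norm_toLp_comp_equiv eₘ.symm _
  rw [h1]
  have h2 := norm_toLp_mulVec_le A (toLp 2 (ofLp x ∘ eₙ))
  have h3 : ‖(toLp 2 (ofLp x ∘ eₙ) : EuclideanSpace ℂ n)‖ = ‖x‖ := by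
    rw [norm_toLp_comp_equiv eₙ (ofLp x)]
  rw [h3] at h2
  exact h2

omit [DecidableEq m] [DecidableEq m'] in
/-- **Reindexing along equivalences preserves the `L²`-operator norm.** [folklore] -/
theorem l2_opNorm_reindex (eₘ : m ≃ m') (eₙ : n ≃ n') (A : Matrix m n ℂ) : ‖Matrix.reindex eₘ eₙ A‖ = ‖A‖ := by
  refine le_antisymm (l2_opNorm_reindex_le eₘ eₙ A) ?_
  have h := l2_opNorm_reindex_le eₘ.symm eₙ.symm (Matrix.reindex eₘ eₙ A)
  rwa [← Matrix.reindex_symm, Equiv.symm_apply_apply] at h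

omit [DecidableEq m] [DecidableEq n] in
/-- The columns of a vector indexed by a product: `‖v‖² = Σ_j ‖v(·, j)‖²`. [folklore] -/
theorem norm_sq_eq_sum_cols (v : EuclideanSpace ℂ (m × n)) :
    ‖v‖ ^ 2 = ∑ j : n, ‖(toLp 2 (fun i : m => ofLp v (i, j)) : EuclideanSpace ℂ m)‖ ^ 2 := by
  rw [EuclideanSpace.norm_sq_eq, Fintype.sum_prod_type, Finset.sum_comm]
  refine Finset.sum_congr rfl fun j _ => ?_
  rw [EuclideanSpace.norm_sq_eq]

/-- **`‖U ⊗ 1‖ ≤ ‖U‖`.** [folklore] -/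
theorem l2_opNorm_kronecker_one_le (U : Matrix m m ℂ) : ‖Matrix.kroneckerMap (· * ·) U (1 : Matrix n n ℂ)‖ ≤ ‖U‖ := by
  refine l2_opNorm_le_of_forall_mulVec _ (norm_nonneg U) fun x => ?_
  have hcol : ∀ j : n, (fun i : m => (Matrix.kroneckerMap (· * ·) U (1 : Matrix n n ℂ) *ᵥ ofLp x) (i, j)) =
      U *ᵥ fun i' => ofLp x (i', j) := by
    intro j; funext i
    simp only [Matrix.mulVec, dotProduct, Matrix.kroneckerMap_apply, Fintype.sum_prod_type, Matrix.one_apply, mul_ite,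
      mul_one, mul_zero, ite_mul, zero_mul]
    refine Finset.sum_congr rfl fun i' _ => ?_
    rw [Finset.sum_ite_eq]; simp
  have hsq : ‖(toLp 2 (Matrix.kroneckerMap (· * ·) U (1 : Matrix n n ℂ) *ᵥ ofLp x) : EuclideanSpace ℂ (m × n))‖ ^ 2 ≤
      (‖U‖ * ‖x‖) ^ 2 := by
    rw [norm_sq_eq_sum_cols, mul_pow, norm_sq_eq_sum_cols x, Finset.mul_sum]
    refine Finset.sum_le_sum fun j _ => ?_
    have h := norm_toLp_mulVec_le U (toLp 2 fun i' => ofLp x (i', j))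
    have h' : (fun i : m => ofLp (toLp 2 (Matrix.kroneckerMap (· * ·) U (1 : Matrix n n ℂ) *ᵥ ofLp x)) (i, j)) =
        U *ᵥ fun i' => ofLp x (i', j) := by rw [ofLp_toLp]; exact hcol j
    rw [h', ← mul_pow]
    exact pow_le_pow_left₀ (norm_nonneg _) h 2
  exact (pow_le_pow_iff_left₀ (norm_nonneg _) (mul_nonneg (norm_nonneg _) (norm_nonneg _)) two_ne_zero).1 hsq

end Generic

/-! ### Placed gates -/

/-- **Placing a gate does not increase its norm**: `‖placeGate e U‖ ≤ ‖U‖`. [cite: NielsenChuang2010, §4.3] -/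
theorem norm_placeGate_le {k n : ℕ} (e : Fin k ↪ Fin n) (U : Matrix (QReg k) (QReg k) ℂ) : ‖placeGate e U‖ ≤ ‖U‖ := by
  rw [placeGate_eq_reindex_kronecker_holds e U, l2_opNorm_reindex]
  exact l2_opNorm_kronecker_one_le U

/-- Hence `‖placeGate e U - placeGate e V‖ ≤ ‖U - V‖`. [folklore] -/
theorem norm_placeGate_sub_placeGate_le {k n : ℕ} (e : Fin k ↪ Fin n) (U V : Matrix (QReg k) (QReg k) ℂ) :
    ‖placeGate e U - placeGate e V‖ ≤ ‖U - V‖ := by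
  have h : placeGate e U - placeGate e V = placeGate e (U - V) := by
    ext x y; simp only [Matrix.sub_apply, placeGate_apply]; split_ifs <;> simp
  rw [h]; exact norm_placeGate_le e _

end Literature.Computability.QuantumComplexity

end
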